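import Mathlib

/-!
# `BalabanImbrieJaffe1984to88.BIJ88LocTransl5126` — T. Bałaban, J. Imbrie, A. Jaffe, *Effective action and cluster properties
of the abelian Higgs model*, Commun. Math. Phys. **114** (1988) 257–315 [BalabanImbrieJaffe1988], §5.12 *Conditional
Integration*, pp. 301–302: the translation **(5.12.4)** with its effect on the `δ`-functions, and the localized translations
**(5.12.6)** with the residual linear forms of **(5.12.7)** — PROVED as the linear / quadratic-form identities they are

statement-level skeleton of published theorems with citation tags; proofs where landed; nothing here is a claim about the Yang–Mills mass gap

PDF held: `paper:balaban1988-cmp114-bij-abelian-higgs-effective-action` (journal page = PDF page + 256).  Renders read this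
session: p. 301 = PDF 45, p. 302 = PDF 46 (`pages/original-p045-x2.png`, `-p046-x2.png` of the p02 seat, read as images).

**What the paper prints (verbatim).**  p. 301: *"We calculate (5.12.3) by means of a translation A^{(k)} = A^{(k)′} −
Λ^{(k)c*c}_{10}Q^{s*}QΛ^{(k)c*}_{10}A^{(k)}, (5.12.4) which removes the dependence on Λ^{(k)c*}_{10}A^{(k)} in the δ-functions. In fact,
δ_{Ax,Λ^{(k)′}_{10}}(A^{(k)}) = δ_{Ax,Λ^{(k)′}_{10}}(A^{(k)′}), and since QQ^{s*} = I, δ_{Λ^{(k)′c*c}_{10}}(QA^{(k)}) =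
δ_{Λ^{(k)′c*c}_{10}}(QΛ^{(k)c*c}_{10}A^{(k)′}). The fourth quadratic form above is obtained by collecting the terms in the exponential
quadratic in Λ^{(k)c*}_{10}A^{(k)}. There remains a linear form ⟨Λ^{(k)c*c}_{10}A^{(k)′}, ∂*σ_{k,loc}∂(I − Λ^{(k)c*c}_{10}Q^{s*}Q)Λ^{(k)c*}_{10}A^{(k)}⟩,
(5.12.5)"*.  p. 302: *"We make the same translation (5.12.4) in both numerator and denominator of the normalized integral in
Λ^{(k)}_{10}. Terms quadratic in Λ^{(k)c*}_{10}A^{(k)} cancel, but we still have the linear forms (5.12.5) and ⟨Λ^{(k)}_{10}φ^{(k)},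
Δ_{k,loc}(u_{k+1})Λ^{(k)c}_{10}φ^{(k)}⟩ as in our last calculation. We remove most of these forms with localized translations A^{(k)′} =
A^{(k)″} − C^{(k)}_{Λ^{(k)c*c}_{10},loc}∂*σ_{k,loc}∂(I − L^{−1}Λ^{(k)c*c}_{10}Q^{s*}Q)Λ^{(k)c*}_{10}A^{(k)}, φ^{(k)} = φ^{(k)″} −
C^{(k)}_{Λ^{(k)}_{10},loc}(u_{k+1})Δ_{k,loc}(u_{k+1})Λ^{(k)c}_{10}φ^{(k)}. (5.12.6) Terms quadratic in Λ^{(k)c*}_{10}A^{(k)} or Λ^{(k)c}_{10}φ^{(k)}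
cancel as before, leaving the following integral: … (5.12.7)"* — whose exponent carries *"−½⟨Λ^{(k)}_{10}φ^{(k)″}, (Δ_{k,loc}(u_{k+1})
+ aL^{−2}P(u_{k+1}))Λ^{(k)}_{10}φ^{(k)″}⟩ … − ⟨Λ^{(k)}_{10}φ^{(k)″}, (I − (Δ_{k,loc}(u_{k+1}) + aL^{−2}P(u_{k+1}))C^{(k)}_{Λ^{(k)}_{10},loc}(u_{k+1}))
Δ_{k,loc}(u_{k+1})Λ^{(k)c}_{10}φ^{(k)}⟩"* and the analogous `A″` lines.

**What is reproduced here (kernel-checked, zero `sorry`, no named facts).**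
* **(5.12.4) and the `δ`-function sentence** (`eq5124_delta`): with the block averaging split as `Q = Q_in + Q_ext` (interior
  variables `Λ^{c*c}_{10}A`, exterior `Λ^{c*}_{10}A`) and `Q_inQ^{s*} = I` (*"QQ^{s*} = I"* on the interior blocks), the translated
  interior field `A_in = A′ − Q^{s*}Q_ext(A_ext)` satisfies `Q_inA_in + Q_extA_ext = Q_inA′` — the constraint no longer sees the
  exterior field; `eq5124_axial`: a factor depending on `A` only through a linear map `T` with `TQ^{s*} = 0` is unchanged
  (declared reading of *"δ_{Ax}(A^{(k)}) = δ_{Ax}(A^{(k)′})"*).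
* **(5.12.6)–(5.12.7), the approximate completion of the square** (`approxSquare`): for a symmetric operator `M`, ANY operator
  `C` and a source `ℓ`, translating `φ = φ″ − Cℓ` in `½⟨φ, Mφ⟩ + ⟨φ, ℓ⟩` leaves `½⟨φ″, Mφ″⟩ + ⟨φ″, (I − MC)ℓ⟩ + const` — the
  residual linear form `(I − MC)ℓ` is exactly the printed `(I − (Δ_{k,loc} + aL^{−2}P)C_{loc})Δ_{k,loc}Λ^cφ` (`M = Δ_{k,loc} + aL^{−2}P`,
  `C = C^{(k)}_{Λ_{10},loc}`, `ℓ = Δ_{k,loc}Λ^{c}_{10}φ^{(k)}`) resp. `(I − ∂*σ∂C_{loc})∂*σ∂(I − L^{−1}ΛQ^{s*}Q)Λ^{c*}A` for the gauge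
  field; `approxSquare_exact`: with an exact inverse (`MCℓ = ℓ`) the linear form disappears (the ordinary completion of the
  square); **`eq5127_exponent`**: the printed shape of the `φ″`-lines of (5.12.7), the field-independent constant being what
  *"cancel[s] as before"* between numerator and denominator.

**Readings (declared).**  (i) `Q`, `Q^{s*}`, `C_{loc}`, `Δ_{k,loc}`, `∂*σ_{k,loc}∂` are abstract linear maps (the statements are
identities of linear algebra, valid for the model operators); (ii) the axial `δ` is modelled as a function of `TA` with
`TQ^{s*} = 0`; (iii) real inner-product spaces.

**What is NOT claimed.**  (5.12.1)–(5.12.3), (5.12.5) as a Gaussian expectation, the random-walk localizations `C_{loc}` and the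
bound `|W₅^{(k)}(X)| ≤ e^{−cr(e_k)|X|}`, the measure (5.12.7) itself (p10's `BIJ88Conditioning512` has the p. 300 identity);
anything of B1–B16.  NOT summit progress; NOT continuum; NOT Clay.  Imports: Mathlib only; no Summits import; sub-namespace
`…BIJ88LocTransl5126`; modifies nothing.  Cell `lit-balaban` Phase 2, seat p02 gen 4; row C2.Eq5.12.1-5.12.7 (owner r16),
members (5.12.4) (+ δ-sentence) and (5.12.6)/(5.12.7)-exponent «absent» → proved (algebraic readings).
-/

namespace Literature.MathematicalPhysics.QuantumFieldTheory.BalabanImbrieJaffe1984to88.BIJ88LocTransl5126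

/-! ## (5.12.4): the translation and the `δ`-functions -/

section Translation

variable {V W X : Type*} [AddCommGroup V] [Module ℝ V] [AddCommGroup W] [Module ℝ W] [AddCommGroup X] [Module ℝ X]

/-- **(5.12.4)** p. 301: the translated interior field `Λ^{c*c}_{10}A^{(k)} = A^{(k)′} − Q^{s*}QΛ^{c*}_{10}A^{(k)}` (interior
configurations `V`, exterior configurations `X`, block fields `W`; `Qext` = the exterior part `QΛ^{c*}_{10}` of the averaging).
[cite: BalabanImbrieJaffe1988, (5.12.4) p.301] -/
def transl5124 (Qs : W →ₗ[ℝ] V) (Qext : X →ₗ[ℝ] W) (A' : V) (Aext : X) : V :=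
  A' - Qs (Qext Aext)

/-- **p. 301, verbatim: *"… which removes the dependence on Λ^{(k)c*}_{10}A^{(k)} in the δ-functions. … since QQ^{s*} = I,
δ_{Λ′^{c*c}_{10}}(QA^{(k)}) = δ_{Λ′^{c*c}_{10}}(QΛ^{(k)c*c}_{10}A^{(k)′})"*** — PROVED: with `Q = Q_in ⊕ Q_ext` and `Q_inQ^{s*} = I`,
`Q_in(A′ − Q^{s*}Q_extA_ext) + Q_extA_ext = Q_inA′`. [cite: BalabanImbrieJaffe1988, (5.12.4) p.301] -/
theorem eq5124_delta (Qin : V →ₗ[ℝ] W) (Qs : W →ₗ[ℝ] V) (Qext : X →ₗ[ℝ] W) (h : Qin ∘ₗ Qs = LinearMap.id)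
    (A' : V) (Aext : X) : Qin (transl5124 Qs Qext A' Aext) + Qext Aext = Qin A' := by
  have hQ : Qin (Qs (Qext Aext)) = Qext Aext := by
    have := LinearMap.congr_fun h (Qext Aext)
    simpa using this
  rw [transl5124, map_sub, hQ, sub_add_cancel]

/-- *"δ_{Ax,Λ′_{10}}(A^{(k)}) = δ_{Ax,Λ′_{10}}(A^{(k)′})"* (p. 301) — under the declared reading: a factor seeing `A` only through
a linear map `T` that kills the range of `Q^{s*}` is unchanged by the translation. [cite: BalabanImbrieJaffe1988, (5.12.4) p.301] -/
theorem eq5124_axial {Y Z : Type*} [AddCommGroup Y] [Module ℝ Y] (T : V →ₗ[ℝ] Y) (Qs : W →ₗ[ℝ] V) (Qext : X →ₗ[ℝ] W)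
    (hT : T ∘ₗ Qs = 0) (δAx : Y → Z) (A' : V) (Aext : X) :
    δAx (T (transl5124 Qs Qext A' Aext)) = δAx (T A') := by
  have h0 : T (Qs (Qext Aext)) = 0 := by
    have := LinearMap.congr_fun hT (Qext Aext)
    simpa using this
  rw [transl5124, map_sub, h0, sub_zero]

end Translation

/-! ## (5.12.6)–(5.12.7): localized translations = approximate completion of the square -/

section Square

open scoped RealInnerProductSpace

variable {E : Type*} [NormedAddCommGroup E] [InnerProductSpace ℝ E]

/-- **(5.12.6)** p. 302: the localized translation `φ = φ″ − Cℓ` (`C` = the localized covariance `C^{(k)}_{Λ_{10},loc}(u_{k+1})`,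
`ℓ = Δ_{k,loc}(u_{k+1})Λ^{(k)c}_{10}φ^{(k)}`; likewise for `A′ = A″ − C_{loc}∂*σ∂(I − L^{−1}ΛQ^{s*}Q)Λ^{c*}A`).
[cite: BalabanImbrieJaffe1988, (5.12.6) p.302] -/
def transl5126 (C : E →ₗ[ℝ] E) (φ'' ℓ : E) : E :=
  φ'' - C ℓ

/-- **the approximate completion of the square**: for symmetric `M` and any `C`,
`½⟨φ″−Cℓ, M(φ″−Cℓ)⟩ + ⟨φ″−Cℓ, ℓ⟩ = ½⟨φ″, Mφ″⟩ + ⟨φ″, ℓ − MCℓ⟩ + (½⟨Cℓ, MCℓ⟩ − ⟨Cℓ, ℓ⟩)` — the residual linear form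
`(I − MC)ℓ` of (5.12.7). [cite: BalabanImbrieJaffe1988, (5.12.7) p.302] -/
theorem approxSquare (M C : E →ₗ[ℝ] E) (hM : M.IsSymmetric) (φ'' ℓ : E) :
    (1 / 2 : ℝ) * ⟪transl5126 C φ'' ℓ, M (transl5126 C φ'' ℓ)⟫ + ⟪transl5126 C φ'' ℓ, ℓ⟫ =
      (1 / 2 : ℝ) * ⟪φ'', M φ''⟫ + ⟪φ'', ℓ - M (C ℓ)⟫ + ((1 / 2 : ℝ) * ⟪C ℓ, M (C ℓ)⟫ - ⟪C ℓ, ℓ⟫) := by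
  have hsym : ⟪C ℓ, M φ''⟫ = ⟪φ'', M (C ℓ)⟫ := by
    rw [← hM (C ℓ) φ'', real_inner_comm]
  simp only [transl5126, map_sub, inner_sub_left, inner_sub_right]
  rw [hsym]
  ring

/-- … with an EXACT inverse on the source (`MCℓ = ℓ`) the linear form disappears: the ordinary completion of the square
`½⟨φ, Mφ⟩ + ⟨φ, ℓ⟩ = ½⟨φ″, Mφ″⟩ − ½⟨Cℓ, ℓ⟩`. [cite: BalabanImbrieJaffe1988, (5.12.7) p.302] -/
theorem approxSquare_exact (M C : E →ₗ[ℝ] E) (hM : M.IsSymmetric) (φ'' ℓ : E) (hinv : M (C ℓ) = ℓ) :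
    (1 / 2 : ℝ) * ⟪transl5126 C φ'' ℓ, M (transl5126 C φ'' ℓ)⟫ + ⟪transl5126 C φ'' ℓ, ℓ⟫ =
      (1 / 2 : ℝ) * ⟪φ'', M φ''⟫ - (1 / 2 : ℝ) * ⟪C ℓ, ℓ⟫ := by
  rw [approxSquare M C hM, hinv, sub_self, inner_zero_right]
  ring

/-- **(5.12.7), the `φ″`-lines of the exponent**, verbatim shape: *"−½⟨Λ_{10}φ″, (Δ_{k,loc} + aL^{−2}P)Λ_{10}φ″⟩ − ⟨Λ_{10}φ″,
(I − (Δ_{k,loc} + aL^{−2}P)C_{Λ_{10},loc})Δ_{k,loc}Λ^{c}_{10}φ⟩"* — PROVED: the exponent `−½⟨φ, Mφ⟩ − ⟨φ, ℓ⟩` (interior quadratic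
form `M` and the interior–exterior cross term `ℓ = Δ_{k,loc}Λ^cφ` of (5.12.2)) becomes, after (5.12.6), `−½⟨φ″, Mφ″⟩ −
⟨φ″, (I − MC)ℓ⟩ − c` with the field-independent `c = ½⟨Cℓ, MCℓ⟩ − ⟨Cℓ, ℓ⟩` (absorbed in the normalization: *"Terms quadratic in
Λ^{c}_{10}φ^{(k)} cancel as before"*). [cite: BalabanImbrieJaffe1988, (5.12.7) p.302] -/
theorem eq5127_exponent (M C : E →ₗ[ℝ] E) (hM : M.IsSymmetric) (φ'' ℓ : E) :
    -((1 / 2 : ℝ) * ⟪transl5126 C φ'' ℓ, M (transl5126 C φ'' ℓ)⟫) - ⟪transl5126 C φ'' ℓ, ℓ⟫ =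
      -((1 / 2 : ℝ) * ⟪φ'', M φ''⟫) - ⟪φ'', ((LinearMap.id : E →ₗ[ℝ] E) - M ∘ₗ C) ℓ⟫
        - ((1 / 2 : ℝ) * ⟪C ℓ, M (C ℓ)⟫ - ⟪C ℓ, ℓ⟫) := by
  have h := approxSquare M C hM φ'' ℓ
  have hlin : ((LinearMap.id : E →ₗ[ℝ] E) - M ∘ₗ C) ℓ = ℓ - M (C ℓ) := by simp
  rw [hlin]
  linarith

end Square

end Literature.MathematicalPhysics.QuantumFieldTheory.BalabanImbrieJaffe1984to88.BIJ88LocTransl5126
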